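import Literature.MathematicalPhysics.QuantumLattice.HubbardNNNHoppingTorusLimitCorrelator
import Literature.MathematicalPhysics.QuantumLattice.HubbardSquareTorusLimitState
import HarnessLib

/-!
# Thermodynamic-limit states of `t–t'` square-lattice sector ground states (the state class "(I)" at
# the doped `t–t'` point) and the transport of lower bounds to `energyDensityTT'`

Topic `MathematicalPhysics/QuantumLattice`. The `t–t'` twin of `HubbardSquareTorusLimitState.lean`
(pure Hubbard, `t' = 0`). Ruelle's ground-state energy density
`energyDensityTT' t t' U n` (`HubbardNNNHoppingThermodynamicLimit.lean`; `U ≥ 0`, `0 ≤ n < 2`) of the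
square-lattice Hubbard model with next-nearest-neighbour hopping `t'` is carried by a
translation-invariant, even infinite-volume state `ω` on `ℤ²` that is a TORUS LIMIT of unit ground
states of `hubbardTorusTT' L t t' U` in the joint sectors `(N, S^z) = (rectN n L, 0)` (tree:
`exists_isTorusLimitOf_meanEnergy_hubbardTTPrime_eq`, `HubbardNNNHoppingTorusLimitCorrelator.lean`
§Energy). Here we add the spin densities `ω(n_{0↑}) = ω(n_{0↓}) = n/2` of such a limit
(`IsTorusLimitOf.expect_nAt_eq_of_szSector`, any `d`) and state the resulting TRANSPORT: a real number
`E` that bounds from below the `t–t'` mean energy of every such state is a lower bound on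
`energyDensityTT' t t' U n` — the node shape of certificates at the doped `t–t'` point whose rows hold
for translation-invariant states of the infinite lattice (positivity, translation / point-group
identifications, Pauli–Markov one-body cuts) and for limits of torus eigenstates (commutator / KKT
rows), exactly as `le_energyDensity2D_of_forall_torusLimit` at `t' = 0` and
`le_hubbardChainEnergyDensityAt_of_forall_torusLimit` for the chain.

* `exists_isTorusLimitOf_squareGroundStatesTT'_meanEnergy_eq` — the class is non-empty and carries
  `energyDensityTT' t t' U n`, density `n`, spin densities `n/2`.
* `le_energyDensityTT'_of_forall_torusLimit` — transport of lower bounds valid on the class.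
* `le_energyDensityTT'_of_forall_isTranslationInvariant` — the weaker class (translation invariance,
  evenness, density only).

Everything is PROVED from the tree (Ruelle 1969 §3.4; Bratteli–Kishimoto–Robinson 1978 §3; Lieb 1989
eq. (2) for the `S^z = 0` sectors); no definition, no named fact.
-/

noncomputable section

namespace Literature.MathematicalPhysics.QuantumLattice

open Matrix Finset HubbardWave0 _root_.Filter Literature.Probability.LatticeModels ThermodynamicLimit
open scoped _root_.Topology ComplexOrder

section TTPrime

variable (t t' : ℝ)

/-- **`t–t'` square-lattice sector ground states have translation-invariant thermodynamic-limit states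
carrying `energyDensityTT'`.** For `U ≥ 0` and `0 ≤ n < 2` there are: a family `ψ` of unit vectors on
the tori `(ℤ/Lℤ)²` that are ground states of `hubbardTorusTT' L t t' U` in the sectors
`(rectN n L, S^z = 0)`, sides `L_j → ∞`, and an infinite-volume state `ω` on `ℤ²` that is their torus
limit along `L_j` — translation invariant and even, of particle density `n`, spin densities
`ω(n_{0↑}) = ω(n_{0↓}) = n/2`, with `ω.meanEnergy (hubbardTTPrimeFermionInteraction t t' U) 1 =
energyDensityTT' t t' U n`. [cite: Ruelle1969, §3.4; BratteliKishimotoRobinson1978, §3] -/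
theorem exists_isTorusLimitOf_squareGroundStatesTT'_meanEnergy_eq {U : ℝ} (hU : 0 ≤ U)
    {n : ℝ} (hn0 : 0 ≤ n) (hn2 : n < 2) :
    ∃ (ψ : ∀ L, Fock (Orb (FermionTorus 2 L))) (Ls : ℕ → ℕ) (ω : InfVolFermionState 2),
      Tendsto Ls atTop atTop ∧ ω.IsTorusLimitOf ψ Ls ∧ ω.IsTranslationInvariant ∧ ω.IsEven ∧
      (∀ j, star (ψ (Ls j)) ⬝ᵥ ψ (Ls j) = 1) ∧
      (∀ j, IsGroundStateInSector (hubbardTorusTT' (Ls j) t t' U) (rectN n (Ls j)) 0 (ψ (Ls j))) ∧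
      ω.density = n ∧
      (∀ σ : Fin 2, ω.expect {0} (nAt 0 (Finset.mem_singleton_self 0) σ) = (((n / 2 : ℝ)) : ℂ)) ∧
      ω.meanEnergy (hubbardTTPrimeFermionInteraction t t' U) 1 = energyDensityTT' t t' U n := by
  obtain ⟨ψ, φ, ω, hφ, hψ, hψ1, hω, hti, hev, hdens, he⟩ :=
    exists_isTorusLimitOf_meanEnergy_hubbardTTPrime_eq t t' hU hn0 hn2 tendsto_id
  have hφ' : Tendsto (id ∘ φ) atTop atTop := hφ.tendsto_atTop
  refine ⟨ψ, id ∘ φ, ω, hφ', hω, hti, hev, fun j => hψ1 _, fun j => hψ _, hdens, fun σ => ?_, he⟩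
  exact hω.expect_nAt_eq_of_szSector hφ' (fun j => (hψ _).1) (fun j => hψ1 _)
    ((tendsto_rectN_div_sq hn0).comp hφ') σ

/-- **Corollary (transport of lower bounds valid for translation-invariant limit states, `t–t'`).** If a
real number `E` is a lower bound on the `t–t'` mean energy
`ω.meanEnergy (hubbardTTPrimeFermionInteraction t t' U) 1` of every translation-invariant, even
infinite-volume state `ω` on `ℤ²` of density `n` and spin densities `n/2` that is a torus limit of unit
`(rectN n L, S^z = 0)`-sector ground states of `hubbardTorusTT' L t t' U` — the hypothesis class of a
square-lattice `t–t'` bootstrap certificate whose rows hold for translation-invariant states of the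
infinite lattice (positivity, translation / point-group identifications, Pauli–Markov one-body cuts,
further state inequalities) and for limits of torus eigenstates (commutator rows) — then
`E ≤ energyDensityTT' t t' U n` (`U ≥ 0`, `0 ≤ n < 2`; e.g. the doped point `U = 8`, `n = 7/8`,
`t' = -1/4`). [cite: Ruelle1969, §3.4] -/
theorem le_energyDensityTT'_of_forall_torusLimit {U : ℝ} (hU : 0 ≤ U) {n : ℝ} (hn0 : 0 ≤ n) (hn2 : n < 2)
    {E : ℝ}
    (hE : ∀ (ω : InfVolFermionState 2) (ψ : ∀ L, Fock (Orb (FermionTorus 2 L))) (Ls : ℕ → ℕ),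
      Tendsto Ls atTop atTop → ω.IsTorusLimitOf ψ Ls → ω.IsTranslationInvariant → ω.IsEven →
      (∀ j, star (ψ (Ls j)) ⬝ᵥ ψ (Ls j) = 1) →
      (∀ j, IsGroundStateInSector (hubbardTorusTT' (Ls j) t t' U) (rectN n (Ls j)) 0 (ψ (Ls j))) →
      ω.density = n →
      (∀ σ : Fin 2, ω.expect {0} (nAt 0 (Finset.mem_singleton_self 0) σ) = (((n / 2 : ℝ)) : ℂ)) →
      E ≤ ω.meanEnergy (hubbardTTPrimeFermionInteraction t t' U) 1) :
    E ≤ energyDensityTT' t t' U n := by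
  obtain ⟨ψ, Ls, ω, hLs, hω, hti, hev, h1, hgs, hdens, hspin, he⟩ :=
    exists_isTorusLimitOf_squareGroundStatesTT'_meanEnergy_eq t t' hU hn0 hn2
  rw [← he]
  exact hE ω ψ Ls hLs hω hti hev h1 hgs hdens hspin

/-- The same transport without the spin-density and sector data in the hypothesis (for certificates
whose rows use only translation invariance, evenness and the density). [cite: Ruelle1969, §3.4] -/
theorem le_energyDensityTT'_of_forall_isTranslationInvariant {U : ℝ} (hU : 0 ≤ U) {n : ℝ} (hn0 : 0 ≤ n)
    (hn2 : n < 2) {E : ℝ}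
    (hE : ∀ ω : InfVolFermionState 2, ω.IsTranslationInvariant → ω.IsEven → ω.density = n →
      E ≤ ω.meanEnergy (hubbardTTPrimeFermionInteraction t t' U) 1) :
    E ≤ energyDensityTT' t t' U n := by
  obtain ⟨ψ, Ls, ω, -, -, hti, hev, -, -, hdens, -, he⟩ :=
    exists_isTorusLimitOf_squareGroundStatesTT'_meanEnergy_eq t t' hU hn0 hn2
  rw [← he]
  exact hE ω hti hev hdens

/-- At `t' = 0` the `t–t'` transport is the transport to `energyDensity2D` (`energyDensityTT'_zero`):
a lower bound valid on the `t–t'` class at `t' = 0` bounds `energyDensity2D t U n`.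
[cite: Ruelle1969, §3.4] -/
theorem le_energyDensity2D_of_forall_torusLimit_TT'_zero {U : ℝ} (hU : 0 ≤ U) {n : ℝ} (hn0 : 0 ≤ n)
    (hn2 : n < 2) {E : ℝ}
    (hE : ∀ (ω : InfVolFermionState 2) (ψ : ∀ L, Fock (Orb (FermionTorus 2 L))) (Ls : ℕ → ℕ),
      Tendsto Ls atTop atTop → ω.IsTorusLimitOf ψ Ls → ω.IsTranslationInvariant → ω.IsEven →
      (∀ j, star (ψ (Ls j)) ⬝ᵥ ψ (Ls j) = 1) →
      (∀ j, IsGroundStateInSector (hubbardTorusTT' (Ls j) t 0 U) (rectN n (Ls j)) 0 (ψ (Ls j))) →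
      ω.density = n →
      (∀ σ : Fin 2, ω.expect {0} (nAt 0 (Finset.mem_singleton_self 0) σ) = (((n / 2 : ℝ)) : ℂ)) →
      E ≤ ω.meanEnergy (hubbardTTPrimeFermionInteraction t 0 U) 1) :
    E ≤ energyDensity2D t U n := by
  rw [← energyDensityTT'_zero t U n]
  exact le_energyDensityTT'_of_forall_torusLimit t 0 hU hn0 hn2 hE

end TTPrime

end Literature.MathematicalPhysics.QuantumLattice

end
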